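import Literature.Computability.ImplicitComplexity.STASubstData
import Literature.Computability.ImplicitComplexity.STAProperty1
import HarnessLib

/-!
# Substitution data below a soft promotion (case `(sp)` of the substitution lemma)

Support file for the `PTIME` soundness half of `STACapturesP` (GMR08 Thm. 3.5). In the `(sp)`
case of GR07's substitution lemma the judgement is `!Θ₀ ⊢ M : !σ`, so every substituted term has
a modal type and, by GMR08 Property 1 (`MTyping.property1`), its derivation is a box: a
derivation of the un-promoted type in a context `Γ'` with `!Γ'` included in its context, of
degree one less and weight divided by `r`. `SubstData.lower` performs this for all slots at
once: typed substitution data out of `!Θ₀` with costs `cost i` yields data out of `Θ₀` with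
costs `cost' i`, `cost i = r · cost' i`, degrees `≤ D - 1`, and pieces `Δ' i` with `!Δ' i`
included in `Δ i` (`SubstData.iUnion_lower_le` for the unions).

## References

* [GaboardiMarionRonchidellarocca2008] GMR08, Property 1, §3.1 (Lemma 3.4), Def. A.1
  (`W((sp) Σ, r) = r · W(Σ, r)`).
* [GaboardiRonchiDellaRocca2007] GR07, §4 (Substitution Lemma, case `(sp)`).
-/

namespace Literature.Computability.ImplicitComplexity

namespace STA

namespace SubstData

variable {r D : ℕ} {Θ₀ : Ctx} {θ : ℕ → Term} {Δ : ℕ → Ctx} {cost : ℕ → ℕ}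

/-- **Lowering substitution data through a promotion.** Typed substitution data out of `!Θ₀`
(degrees `≤ D`, costs `cost`) gives typed substitution data out of `Θ₀` with degrees `≤ D - 1`,
costs `cost'` with `cost i = r * cost' i`, and pieces whose promotions are included in the
original pieces. [cite: GaboardiMarionRonchidellarocca2008, Property 1 and §3.1] -/
theorem lower (hS : SubstData r D Θ₀.bang θ Δ cost) :
    ∃ (Δ' : ℕ → Ctx) (cost' : ℕ → ℕ), SubstData r (D - 1) Θ₀ θ Δ' cost' ∧
      (∀ i, cost i = r * cost' i) ∧
      (∀ i i', Δ' i i' ≠ none → Δ i i' = (Δ' i i').map SoftTy.bang) := by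
  -- slotwise choice of the lowered piece and cost
  have key : ∀ i, ∃ p : Ctx × ℕ,
      cost i = r * p.2 ∧
      (∀ i', p.1 i' ≠ none → Δ i i' = (p.1 i').map SoftTy.bang) ∧
      (Θ₀ i = none → (∀ i', p.1 i' = none) ∧ p.2 = 0) ∧
      (∀ τ, Θ₀ i = some τ →
        (∃ i', θ i = .var i' ∧ Ctx.IsSingleton p.1 i' τ ∧ p.2 = 0) ∨
        (∃ dᵢ, dᵢ ≤ D - 1 ∧ MTyping r p.2 dᵢ p.1 (θ i) τ)) := by
    intro i
    cases hΘ : Θ₀ i with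
    | none =>
      refine ⟨(Ctx.empty, 0), ?_, fun i' h => absurd rfl h, fun _ => ⟨fun _ => rfl, rfl⟩,
        fun τ h => by cases h⟩
      have := hS.cost_eq_zero (i := i) (by simp [Ctx.bang, hΘ])
      simp [this]
    | some τ =>
      have hΘb : Θ₀.bang i = some τ.bang := by simp [Ctx.bang, hΘ]
      rcases hS.slot i τ.bang hΘb with ⟨i', hθ, hsing, hc⟩ | ⟨dᵢ, hd, hder⟩
      · refine ⟨(fun j => if j = i' then some τ else none, 0), by simp [hc], fun j hj => ?_,
          (fun h => by cases h), fun τ' hτ' => ?_⟩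
        · by_cases hji : j = i'
          · subst hji; simp [hsing.1]
          · simp [hji] at hj
        · cases hτ'
          exact Or.inl ⟨i', hθ, ⟨by simp, fun j hj => by simp [hj]⟩, rfl⟩
      · obtain ⟨k, A⟩ := τ
        obtain ⟨Γ', d', w', hdd, hww, hder', hle⟩ := hder.property1
        refine ⟨(Γ', w'), hww, hle, (fun h => by cases h), fun τ' hτ' => ?_⟩
        cases hτ'
        exact Or.inr ⟨d', by omega, hder'⟩
  choose p hp using key
  refine ⟨fun i => (p i).1, fun i => (p i).2, ⟨fun i τ hτ => (hp i).2.2.2 τ hτ,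
    fun i hi => (hp i).2.2.1 hi, fun i₁ i₂ i' hne h₁ => ?_, ?_⟩,
    fun i => (hp i).1, fun i i' h => (hp i).2.1 i' h⟩
  · -- disjointness is inherited from the original pieces
    by_contra h₂
    have e₁ := (hp i₁).2.1 i' h₁
    have e₂ := (hp i₂).2.1 i' h₂
    have hΔ₁ : Δ i₁ i' ≠ none := by
      rw [e₁]
      cases h0 : (p i₁).1 i' with
      | none => exact absurd h0 h₁
      | some σ => simp
    have := hS.disj i₁ i₂ i' hne hΔ₁
    rw [this] at e₂
    cases h0 : (p i₂).1 i' with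
    | none => exact h₂ h0
    | some σ => rw [h0] at e₂; cases e₂
  · -- uniform boundedness is inherited as well
    obtain ⟨m, hm⟩ := hS.bdd
    refine ⟨m, fun i i' hi' => ?_⟩
    by_contra hne
    have e := (hp i).2.1 i' hne
    rw [hm i i' hi'] at e
    cases h0 : (p i).1 i' with
    | none => exact hne h0
    | some σ => rw [h0] at e; cases e

/-- The union of the lowered pieces has its promotion included in the union of the pieces.
[folklore] -/
theorem iUnion_lower_le (hS : SubstData r D Θ₀.bang θ Δ cost) {Δ' : ℕ → Ctx} {cost' : ℕ → ℕ}
    {D' : ℕ} (hS' : SubstData r D' Θ₀ θ Δ' cost')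
    (hle : ∀ i i', Δ' i i' ≠ none → Δ i i' = (Δ' i i').map SoftTy.bang) (i' : ℕ)
    (h : (Ctx.iUnion Δ').bang i' ≠ none) : Ctx.iUnion Δ i' = (Ctx.iUnion Δ').bang i' := by
  have h0 : Ctx.iUnion Δ' i' ≠ none := fun e => h (by simp [Ctx.bang, e])
  obtain ⟨i, hi⟩ := Ctx.exists_of_iUnion_ne_none h0
  have hΔ : Δ i i' ≠ none := by
    rw [hle i i' hi]
    cases h1 : Δ' i i' with
    | none => exact absurd h1 hi
    | some σ => simp
  simp only [Ctx.bang]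
  rw [Ctx.iUnion_apply hS.disj hΔ, Ctx.iUnion_apply hS'.disj hi, hle i i' hi]

end SubstData

end STA

end Literature.Computability.ImplicitComplexity
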